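import Summits.AnomalousDissipation.AnomalousDissipation.Theorems.StirringSphereEnsembleRealizationStubAugCurrentLevelPairs
import Summits.AnomalousDissipation.AnomalousDissipation.Theorems.StirringSphereEnsembleRealizationStubAugCurrentPathLaw
import Summits.AnomalousDissipation.AnomalousDissipation.Theorems.StirringSphereEnsembleRealizationStubAugLimit
import Summits.AnomalousDissipation.AnomalousDissipation.Theorems.StirringSphereEnsembleRealizationStubAugWeakForm
import Summits.AnomalousDissipation.AnomalousDissipation.Theorems.StirringSphereEnsembleRealizationStubAugEnergy
import Summits.AnomalousDissipation.AnomalousDissipation.Theorems.StirringSphereEnsembleRealizationStubRestart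

/-!
# Crux `EnsembleRealization` (stmt-AnomalousDissipation-0215) — line `augmented-lift`:
# the ENERGY-AUGMENTED LIFT of a dissipative Foias–Prodi measure (stub B of the line, PROVED from CEI)

Supports stmt-AnomalousDissipation-0215 (registered stub `stub_augmentedLiftOfCEI`; nothing here closes an item).

THE THEOREM (`stub_augmentedLiftOfCEI`, = the line's original stub B `stub_augmentedLift` with its hypothesis
`CEI(ν, f, μ)` — the cylindrically weighted energy inequalities, FP shell inequality (1.31) conditioned on cylindrical
data — kept as an explicit hypothesis `hcei`): a Foias–Prodi stationary statistical solution `μ` of the 3-D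
space-periodic Navier–Stokes equations at `(ν, f)`, carried by the ball `‖u‖ ≤ R` and satisfying `CEI`, admits a
shift-invariant probability law on MomentParity's compact trajectory space `𝒦(R, pathLip ν ‖f‖₁ R)` whose one-time
coefficient marginals are the coefficient law of `μ` and whose typical path is, after a time shift, realised by a
GLOBAL LERAY–HOPF solution. Composition of the landed pieces of the line (all in this namespace):
`stub_augCurrentLevelPairs` + `stub_augCurrentPathLawTools` (level laws of the smooth stationary currents built from
`CEI`) → `stub_augLimit` (compactness + Ambrosio–Trevisan identification) → `stub_augWeakForm` (modewise ⇒ weak form)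
→ `stub_augEnergy` (energy inequality from a.e. time) → `stub_restart` (restart at a good time).
[arXiv:1402.4788 §7; FoiasRosaTemam2019 §2–3; FMRTTurbulence2001 IV (1.29)–(1.31)]
-/

noncomputable section

-- every `Summit.AnomalousDissipation.AnomalousDissipation.…` name repeats the summit = sub-problem segment (D-0017 layout)
set_option linter.dupNamespace false

open MeasureTheory Set Filter Topology Function Metric UnitAddTorus
open scoped BigOperators ENNReal InnerProductSpace RealInnerProductSpace

namespace Summit.AnomalousDissipation.AnomalousDissipation.Theorems.EnsembleRealization

open Literature.Analysis.FunctionSpaces Literature.Analysis.FunctionSpaces.Torus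
open Literature.Analysis.FluidPDE Literature.Analysis.FluidPDE.Torus
open Summit.AnomalousDissipation.AnomalousDissipation.Theorems.MomentParity

variable {ν : ℝ} {f : UnitAddTorus (Fin 3) → EuclideanSpace ℝ (Fin 3)}
  {μ : Measure (Torus.energySpace (Fin 3))}

/-- **Sub-stub M1 (augmented current; XL).** `FP + CEI` on the ball `‖u‖ ≤ R` ⇒ LEVEL LAWS: for
some `b` and every `n`, a probability law `P n` on the compact augmented trajectory space
`𝒦(R, pathLip ν ‖f‖₁ R) × [0, b]^ℚ` (coefficient path `x.1`, energy path `x.2` sampled at rational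
times) such that (i) the path marginal `(P n).map Prod.fst` is shift invariant; (ii) at every
rational time `q ≥ 0` the joint law of `(x.1(q, ·), x.2 q)` tends, as `n → ∞`, to the law of
`(û, ‖u‖²)` under `μ` (against bounded continuous tests); (iii) DRIFT LINK: for every smooth
solenoidal mean-zero test field `a`, every bounded continuous cylindrical observable `c` of the
coefficients and rationals `0 ≤ q ≤ q'`, eventually
`E_{P n} |(x.1(q'), â) − (x.1(q), â) − ∫_q^{q'} c(x̄.1(τ)) dτ| ≤ (q' − q) ‖⟨F(·), a⟩ − c ∘ 𝓕‖_{L¹(μ)} + γ`;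
(iv) ENERGY LINK: for every truncation `K` and rationals `0 ≤ q ≤ q'`, eventually
`E_{P n} (x.2 q' − x.2 q + ∫_q^{q'} (2 pathDiss ν K x.1 τ − 2 (f̂, x̄.1(τ))) dτ)₊ ≤ γ`.
Mechanism (notes `augmentedLaw-notes.md` §M1): level `n = (N, δ, ε, θ)`; coordinates
`ξ(u) = ((u, g₁), …, (u, g_D))` on the real solenoidal mean-zero trigonometric polynomials of
degree `≤ N` (orthonormal `gⱼ`) and `e = ‖u‖²`; the current `J_w = ξ_*(⟨F, gⱼ⟩ μ) * ρ_δ`,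
`J_e(w, e) = −∫_{-∞}^e div_w J_w` (`= −2 (Dμ)^δ − G^δ` with `G^δ = −Λ(ψ_z) ≥ 0` by `CEI` applied
to the primitive-in-`e` of the mollifier, NONINCREASING in `e`; `J_e = 0` off the energy range by
the Liouville identity, i.e. `CEI` for `±ψ(ξ)`), so `div J = 0`, `J` smooth with compact support;
the measure `m = (1 − ε) μ̃ * ρ_δ + ε λ` (`λ` a smooth positive probability density near
`supp J`), the smooth compactly supported field `V = (1 − ε) J / m`, its global flow
(`Literature.Analysis.ODE.globalFlow`), invariance of `m`
(`Literature.Analysis.ODE.map_flow_eq_self_of_forall_integral_fderiv_eq_zero`), the orbit-path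
law (rescaled by `θ = R/(R + 2δ)` in `w` and affinely in `e`) on `𝒦 × [0, b]^ℚ`, shift invariant
by construction; links: `∫ |V_a m − c m| ≤ ‖⟨F, P_N a⟩ − c ∘ 𝓕 ∘ P_N‖_{L¹(μ)} + ω_c(δ) + 2ε‖c‖_∞`,
`E_m (V_e + 2ν D_K − 2 W)₊ ≤ 2 sup|ν D_K − W| ε + 2 η_{n,K}`, `|V_k| ≤ pathLip ν ‖f‖₁ R k − 1`.
[arXiv:1402.4788 §7 (proof of Thm 7.1); FoiasRosaTemam2019 §2–3; FMRTTurbulence2001 IV (1.29)–(1.31)] -/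
theorem augCurrent_of_cei (hν : 0 < ν) (hf : IsSmooth f) (hμ : IsStationaryStatisticalSolution ν f μ)
    (hcei : (∀ (m : ℕ) (g : Fin m → UnitAddTorus (Fin 3) → EuclideanSpace ℝ (Fin 3)),
      (∀ j, IsSmooth (g j)) → (∀ j, IsDivFree (g j)) → (∀ j, HasZeroMean (g j)) →
      ∀ ψ : EuclideanSpace ℝ (Fin m) × ℝ → ℝ, ContDiff ℝ 1 ψ →
        (∃ C : ℝ, ∀ z, |ψ z| ≤ C ∧ ‖fderiv ℝ ψ z‖ ≤ C) →
        (∀ ξ : EuclideanSpace ℝ (Fin m), Monotone fun e : ℝ => ψ (ξ, e)) →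
        Integrable (fun u : Torus.energySpace (Fin 3) =>
            fderiv ℝ ψ (WithLp.toLp 2 fun j => pairing u.1 (g j), ‖u‖ ^ 2) (0, 1) *
              (ν * (eGradNormSq (u.1 : UnitAddTorus (Fin 3) → EuclideanSpace ℝ (Fin 3))).toReal - pairing u.1 f)) μ ∧
        Integrable (fun u : Torus.energySpace (Fin 3) =>
            nsGeneratorPairing ν f u (fun x => ∑ j, fderiv ℝ ψ (WithLp.toLp 2 fun j => pairing u.1 (g j), ‖u‖ ^ 2)
              (EuclideanSpace.single j 1, 0) • g j x)) μ ∧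
        2 * ∫ u, fderiv ℝ ψ (WithLp.toLp 2 fun j => pairing u.1 (g j), ‖u‖ ^ 2) (0, 1) *
              (ν * (eGradNormSq (u.1 : UnitAddTorus (Fin 3) → EuclideanSpace ℝ (Fin 3))).toReal - pairing u.1 f) ∂μ ≤
          ∫ u, nsGeneratorPairing ν f u (fun x => ∑ j, fderiv ℝ ψ (WithLp.toLp 2 fun j => pairing u.1 (g j), ‖u‖ ^ 2)
              (EuclideanSpace.single j 1, 0) • g j x) ∂μ))
    {R : ℝ} (hR : ∀ᵐ u ∂μ, ‖u‖ ≤ R) :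
    ∃ (b : ℝ) (P : ℕ → Measure (↥(pathSpace R (pathLip ν (∫ x, ‖f x‖) R) : Set (Path (Fin 3))) ×
        ↥((Set.univ : Set ℚ).pi fun _ : ℚ => Set.Icc (0 : ℝ) b))),
      (∀ n, IsProbabilityMeasure (P n)) ∧
      (∀ n, ((P n).map Prod.fst).map (pathShiftOn R (pathLip ν (∫ x, ‖f x‖) R)
          (pathShift_mapsTo R (pathLip ν (∫ x, ‖f x‖) R))) = (P n).map Prod.fst) ∧
      (∀ q : ℚ, 0 ≤ q → ∀ φ : ((Fin 3 → ℤ) → EuclideanSpace ℂ (Fin 3)) × ℝ → ℝ, Continuous φ →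
        (∃ B : ℝ, ∀ z, |φ z| ≤ B) →
        Tendsto (fun n => ∫ x, φ ((fun k : Fin 3 → ℤ => x.1.1 (q, k)), x.2.1 q) ∂(P n)) atTop
          (𝓝 (∫ u, φ ((fun k : Fin 3 → ℤ =>
            mFourierCoeff (EuclideanSpace.complexify ∘ (u.1 : UnitAddTorus (Fin 3) → EuclideanSpace ℝ (Fin 3))) k),
            ‖u‖ ^ 2) ∂μ))) ∧
      (∀ a : UnitAddTorus (Fin 3) → EuclideanSpace ℝ (Fin 3), IsSmooth a → IsDivFree a → HasZeroMean a →
        ∀ c : ((Fin 3 → ℤ) → EuclideanSpace ℂ (Fin 3)) → ℝ, Continuous c → (∃ B : ℝ, ∀ z, |c z| ≤ B) →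
        ∀ q q' : ℚ, 0 ≤ q → q ≤ q' → ∀ γ : ℝ, 0 < γ → ∀ᶠ n in atTop,
          ∫ x, |(∑' k, (⟪mFourierCoeff (EuclideanSpace.complexify ∘ a) k, x.1.1 (q', k)⟫_ℂ).re) -
              (∑' k, (⟪mFourierCoeff (EuclideanSpace.complexify ∘ a) k, x.1.1 (q, k)⟫_ℂ).re) -
              ∫ τ in (q : ℝ)..q', c (fun k : Fin 3 → ℤ => pathExt x.1.1 τ k)| ∂(P n) ≤
            ((q' : ℝ) - q) * (∫ u, |nsGeneratorPairing ν f u a - c (fun k : Fin 3 → ℤ =>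
              mFourierCoeff (EuclideanSpace.complexify ∘ (u.1 : UnitAddTorus (Fin 3) → EuclideanSpace ℝ (Fin 3))) k)| ∂μ) + γ) ∧
      (∀ (K : ℕ) (q q' : ℚ), 0 ≤ q → q ≤ q' → ∀ γ : ℝ, 0 < γ → ∀ᶠ n in atTop,
        ∫ x, max 0 (x.2.1 q' - x.2.1 q + ∫ τ in (q : ℝ)..q',
            (2 * pathDiss ν K x.1.1 τ -
              2 * ∑' k, (⟪mFourierCoeff (EuclideanSpace.complexify ∘ f) k, pathExt x.1.1 τ k⟫_ℂ).re)) ∂(P n) ≤ γ) := by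
  obtain ⟨D, g, θ, Bx, m, V, hlev, hmarg, hdrift, henergy⟩ := stub_augCurrentLevelPairs hν hf hμ hcei hR
  -- the level path laws (M1b at every level)
  have hP : ∀ n, ∃ P : Measure (↥(pathSpace R (pathLip ν (∫ x, ‖f x‖) R) : Set (Path (Fin 3))) ×
      ↥((Set.univ : Set ℚ).pi fun _ : ℚ => Set.Icc (0 : ℝ) (R ^ 2 + 1))), _ := fun n => by
    obtain ⟨hg, hgdiv, horth, hθ, hB, hBw, hBe, hprob, hmB, hV, hVc, hVB, hVm, hrate⟩ := hlev n
    exact stub_augCurrentPathLawTools hg hgdiv horth hθ hB hBw hBe (m n) hmB hV hVc hVB hVm hrate ν hf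
  choose P hP1 hP2 hP3 hP4 hP5 using hP
  refine ⟨R ^ 2 + 1, P, hP1, hP2, fun q hq φ hφ hφb => ?_, ?_, ?_⟩
  · -- (MARG): one-time joint laws → law of `(û, ‖u‖²)`
    refine (hmarg φ hφ hφb).congr' (Eventually.of_forall fun n => ?_)
    exact (hP3 n q hq φ hφ).symm
  · -- (DRIFT)
    intro a ha hdiv h0 c hc hcb q q' hq hqq' γ hγ
    have hqq : (0 : ℝ) ≤ (q' : ℝ) - q := by
      have : ((q : ℚ) : ℝ) ≤ q' := by exact_mod_cast hqq'
      linarith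
    have hγ' : 0 < γ / ((q' : ℝ) - q + 1) := div_pos hγ (by linarith)
    have key : ∀ {I X : ℝ}, I ≤ X + γ / ((q' : ℝ) - q + 1) →
        ((q' : ℝ) - q) * I ≤ ((q' : ℝ) - q) * X + γ := fun {I X} h => by
      have h1 := mul_le_mul_of_nonneg_left h hqq
      have h2 : ((q' : ℝ) - q) * (γ / ((q' : ℝ) - q + 1)) ≤ γ := by
        rw [mul_div_assoc', div_le_iff₀ (by linarith)]
        nlinarith
      linarith [h1, h2, mul_add ((q' : ℝ) - q) X (γ / ((q' : ℝ) - q + 1))]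
    filter_upwards [hdrift a ha hdiv h0 c hc hcb _ hγ'] with n hn
    exact (hP4 n a ha c hc hcb q q' hq hqq').trans (key hn)
  · -- (ENERGY)
    intro K q q' hq hqq' γ hγ
    have hqq : (0 : ℝ) ≤ (q' : ℝ) - q := by
      have : ((q : ℚ) : ℝ) ≤ q' := by exact_mod_cast hqq'
      linarith
    have hγ' : 0 < γ / ((q' : ℝ) - q + 1) := div_pos hγ (by linarith)
    filter_upwards [henergy K _ hγ'] with n hn
    refine (hP5 n K q q' hq hqq').trans ?_
    have h1 := mul_le_mul_of_nonneg_left hn hqq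
    have h2 : ((q' : ℝ) - q) * (γ / ((q' : ℝ) - q + 1)) ≤ γ := by
      rw [mul_div_assoc', div_le_iff₀ (by linarith)]
      nlinarith
    exact h1.trans h2


/-- **Stub B-b' (augmented law; XL, the mechanism).** `FP + CEI` on the ball `‖u‖ ≤ R` ⇒ a
shift-invariant probability law on `𝒦(R, pathLip ν ‖f‖₁ R)` with one-time coefficient marginals `μ̂`
whose typical path is the coefficient path of a finite-energy weak solution on `[0, ∞)` with locally
finite enstrophy AND the energy inequality from almost every time (the conclusion of the sibling line's
`stub_superpositionLaw` strengthened by the last clause). Mechanism (wave-1 audit, notes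
`work/stubs/augmentedLift-notes.md`): (M1) from `CEI`, a SMOOTH stationary current at level `(N, δ, ε)`
— mollified joint law of `(P_N u, |u|²)` mixed with `ε` of a smooth positive density, drift = current /
density, one-sided energy component (`CEI` applied to the primitive-in-`e` of the mollifier, no Riesz
step); its flow preserves the level measure by
`Literature.Analysis.ODE.map_flow_eq_self_of_forall_integral_fderiv_eq_zero`, so the level path law is
shift-invariant by construction (no Krylov–Bogoliubov, no non-smooth superposition principle);
(M2) `N → ∞, δ, ε → 0` in the compact `𝒦 × energyPathSpace`: Ambrosio–Trevisan `L¹` identification of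
the modewise drift (conditional expectation is an `L¹` contraction; cylindrical approximation of `F_k`
in `L¹(μ)` by (1.29)), modewise identity ⇒ weak form; (M3) energy passage (lsc violation functional +
portmanteau), graph identity `law(v̂(t), e(t)) = law(û, |u|²)` ⇒ `e(t) = |v(t)|²` a.s., Fubini ⇒ the
energy inequality from a.e. time. [arXiv:1402.4788 §7 Thm 7.1; FoiasRosaTemam2019 §2–3] -/
theorem augmentedLaw_of_cei (hν : 0 < ν) (hf : IsSmooth f) (hdiv : IsDivFree f) (hf0 : HasZeroMean f)
    (hμ : IsStationaryStatisticalSolution ν f μ)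
    (hcei : (∀ (m : ℕ) (g : Fin m → UnitAddTorus (Fin 3) → EuclideanSpace ℝ (Fin 3)),
      (∀ j, IsSmooth (g j)) → (∀ j, IsDivFree (g j)) → (∀ j, HasZeroMean (g j)) →
      ∀ ψ : EuclideanSpace ℝ (Fin m) × ℝ → ℝ, ContDiff ℝ 1 ψ →
        (∃ C : ℝ, ∀ z, |ψ z| ≤ C ∧ ‖fderiv ℝ ψ z‖ ≤ C) →
        (∀ ξ : EuclideanSpace ℝ (Fin m), Monotone fun e : ℝ => ψ (ξ, e)) →
        Integrable (fun u : Torus.energySpace (Fin 3) =>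
            fderiv ℝ ψ (WithLp.toLp 2 fun j => pairing u.1 (g j), ‖u‖ ^ 2) (0, 1) *
              (ν * (eGradNormSq (u.1 : UnitAddTorus (Fin 3) → EuclideanSpace ℝ (Fin 3))).toReal - pairing u.1 f)) μ ∧
        Integrable (fun u : Torus.energySpace (Fin 3) =>
            nsGeneratorPairing ν f u (fun x => ∑ j, fderiv ℝ ψ (WithLp.toLp 2 fun j => pairing u.1 (g j), ‖u‖ ^ 2)
              (EuclideanSpace.single j 1, 0) • g j x)) μ ∧
        2 * ∫ u, fderiv ℝ ψ (WithLp.toLp 2 fun j => pairing u.1 (g j), ‖u‖ ^ 2) (0, 1) *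
              (ν * (eGradNormSq (u.1 : UnitAddTorus (Fin 3) → EuclideanSpace ℝ (Fin 3))).toReal - pairing u.1 f) ∂μ ≤
          ∫ u, nsGeneratorPairing ν f u (fun x => ∑ j, fderiv ℝ ψ (WithLp.toLp 2 fun j => pairing u.1 (g j), ‖u‖ ^ 2)
              (EuclideanSpace.single j 1, 0) • g j x) ∂μ))
    {R : ℝ} (hR0 : 0 ≤ R) (hR : ∀ᵐ u ∂μ, ‖u‖ ≤ R) :
    ∃ Q : Measure ↥(pathSpace R (pathLip ν (∫ x, ‖f x‖) R) : Set (Path (Fin 3))),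
      IsProbabilityMeasure Q ∧
      Q.map (pathShiftOn R (pathLip ν (∫ x, ‖f x‖) R) (pathShift_mapsTo R (pathLip ν (∫ x, ‖f x‖) R))) = Q ∧
      (∀ t, 0 ≤ t → Q.map (fun ω => fun k : Fin 3 → ℤ => pathExt ω.1 t k) =
        μ.map (fun u : Torus.energySpace (Fin 3) => fun k : Fin 3 → ℤ =>
          mFourierCoeff (EuclideanSpace.complexify ∘ (u.1 : UnitAddTorus (Fin 3) → EuclideanSpace ℝ (Fin 3))) k)) ∧
      (∀ᵐ ω ∂Q, ∃ v : ℝ → UnitAddTorus (Fin 3) → EuclideanSpace ℝ (Fin 3),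
        (∀ t, 0 ≤ t → MemLp (v t) 2 volume ∧
          ∀ k, mFourierCoeff (EuclideanSpace.complexify ∘ v t) k = pathExt ω.1 t k) ∧
        (∀ T, 0 < T → IsWeakNSSolutionForcedOn T ν (fun _ => f) (v 0) v) ∧
        (∀ T, 0 < T → MemL2Sobolev 0 T 1 (fun t => EuclideanSpace.complexify ∘ v t)) ∧
        (∀ᵐ s ∂(volume.restrict (Ioi (0 : ℝ))), ∀ t, s ≤ t →
          kineticEnergy (v t) + ν * (∫⁻ τ in Ioo s t, eGradNormSq (v τ)).toReal ≤
            kineticEnergy (v s) + ∫ τ in s..t, ∫ x, ⟪f x, v τ x⟫_ℝ)) := by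
  -- `hdiv`, `hR0` are not needed by the pieces (kept: registered signature)
  have _hdiv := hdiv
  have _hR0 := hR0
  obtain ⟨b, P, hP, hθP, hmargP, hdrift, henergy⟩ := augCurrent_of_cei hν hf hμ hcei hR
  obtain ⟨Q, hQ, hθ, hmarg, hsol⟩ := stub_augLimit hν hf hf0 hμ hR P hP hθP hmargP hdrift henergy
  have hEI := stub_augEnergy (μ := μ) (ν := ν) (hf.memLp 2) Q hmarg
  refine ⟨Q, hQ, hθ, hmarg, ?_⟩
  filter_upwards [hsol, hEI] with ω ⟨v, hvm, hcoef, hmode, hens, hS⟩ hω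
  exact ⟨v, hcoef, fun T hT => (stub_augWeakForm (ν := ν) hf ω.2 hvm hcoef hmode hens T hT).1,
    fun T hT => (stub_augWeakForm (ν := ν) hf ω.2 hvm hcoef hmode hens T hT).2, hω v hcoef hens hS⟩


/-- **The energy-augmented lift of a dissipative Foias–Prodi measure** (registered tools stub
`stub_augmentedLiftOfCEI`; the line's stub B with `CEI` as hypothesis): composition of `augmentedLaw_of_cei` and the
landed `stub_restart`. -/
theorem stub_augmentedLiftOfCEI (hν : 0 < ν) (hf : IsSmooth f) (hdiv : IsDivFree f) (hf0 : HasZeroMean f)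
    (hμ : IsStationaryStatisticalSolution ν f μ)
    (hcei : (∀ (m : ℕ) (g : Fin m → UnitAddTorus (Fin 3) → EuclideanSpace ℝ (Fin 3)),
      (∀ j, IsSmooth (g j)) → (∀ j, IsDivFree (g j)) → (∀ j, HasZeroMean (g j)) →
      ∀ ψ : EuclideanSpace ℝ (Fin m) × ℝ → ℝ, ContDiff ℝ 1 ψ →
        (∃ C : ℝ, ∀ z, |ψ z| ≤ C ∧ ‖fderiv ℝ ψ z‖ ≤ C) →
        (∀ ξ : EuclideanSpace ℝ (Fin m), Monotone fun e : ℝ => ψ (ξ, e)) →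
        Integrable (fun u : Torus.energySpace (Fin 3) =>
            fderiv ℝ ψ (WithLp.toLp 2 fun j => pairing u.1 (g j), ‖u‖ ^ 2) (0, 1) *
              (ν * (eGradNormSq (u.1 : UnitAddTorus (Fin 3) → EuclideanSpace ℝ (Fin 3))).toReal - pairing u.1 f)) μ ∧
        Integrable (fun u : Torus.energySpace (Fin 3) =>
            nsGeneratorPairing ν f u (fun x => ∑ j, fderiv ℝ ψ (WithLp.toLp 2 fun j => pairing u.1 (g j), ‖u‖ ^ 2)
              (EuclideanSpace.single j 1, 0) • g j x)) μ ∧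
        2 * ∫ u, fderiv ℝ ψ (WithLp.toLp 2 fun j => pairing u.1 (g j), ‖u‖ ^ 2) (0, 1) *
              (ν * (eGradNormSq (u.1 : UnitAddTorus (Fin 3) → EuclideanSpace ℝ (Fin 3))).toReal - pairing u.1 f) ∂μ ≤
          ∫ u, nsGeneratorPairing ν f u (fun x => ∑ j, fderiv ℝ ψ (WithLp.toLp 2 fun j => pairing u.1 (g j), ‖u‖ ^ 2)
              (EuclideanSpace.single j 1, 0) • g j x) ∂μ))
    {R : ℝ} (hR0 : 0 ≤ R) (hR : ∀ᵐ u ∂μ, ‖u‖ ≤ R) :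
    ∃ Q : Measure ↥(pathSpace R (pathLip ν (∫ x, ‖f x‖) R) : Set (Path (Fin 3))),
      IsProbabilityMeasure Q ∧
      Q.map (pathShiftOn R (pathLip ν (∫ x, ‖f x‖) R) (pathShift_mapsTo R (pathLip ν (∫ x, ‖f x‖) R))) = Q ∧
      (∀ t, 0 ≤ t → Q.map (fun ω => fun k : Fin 3 → ℤ => pathExt ω.1 t k) =
        μ.map (fun u : Torus.energySpace (Fin 3) => fun k : Fin 3 → ℤ =>
          mFourierCoeff (EuclideanSpace.complexify ∘ (u.1 : UnitAddTorus (Fin 3) → EuclideanSpace ℝ (Fin 3))) k)) ∧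
      (∀ᵐ ω ∂Q, ∃ s : ℝ, 0 ≤ s ∧ ∃ u : ℝ → UnitAddTorus (Fin 3) → EuclideanSpace ℝ (Fin 3),
        IsGlobalLerayHopf ν (fun _ => f) (u 0) u ∧
        ∀ t, 0 ≤ t → MemLp (u t) 2 volume ∧
          ∀ k, mFourierCoeff (EuclideanSpace.complexify ∘ u t) k = pathExt ω.1 (s + t) k) := by
  obtain ⟨Q, hQ, hθ, hmarg, hsol⟩ := augmentedLaw_of_cei hν hf hdiv hf0 hμ hcei hR0 hR
  refine ⟨Q, hQ, hθ, hmarg, ?_⟩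
  filter_upwards [hsol] with ω ⟨v, hcoef, hweak, hsob, hEI⟩
  exact stub_restart hν hf ω.2 hcoef hweak hsob hEI

end Summit.AnomalousDissipation.AnomalousDissipation.Theorems.EnsembleRealization
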